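import Literature.Computability.QuantumComplexity.OracleQuerySlicing
import Literature.Computability.QuantumComplexity.CircuitEmbedding
import HarnessLib

/-!
# Re-targeting the oracle gates of a circuit to a prefixed (keyed) oracle: branchwise semantics

Topic `Literature/Computability/QuantumComplexity`; sequel of `OracleQuerySlicing.lean` (one enlarged oracle gate acts,
on the branch where its `P` prefix query wires read `c`, as the oracle gate of the slice `prefixSlice A c̄`) and of
`KeyDiagonalAveraging.lean` (block-diagonality in a classical register). Given a circuit `gs` on `N₀` wires WITH
ORACLE GATES, a wire embedding `emb : Fin N₀ ↪ Fin N` into a larger register and `P` PREFIX wires `p` of that register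
disjoint from the image, the RE-TARGETED circuit `retarget p emb h gs` transports every gate along `emb` and enlarges
every oracle query by the prefix wires (query `u ↦ (prefix content) ++ u`). This is the circuit-level form of running
an oracle algorithm as a subroutine "with part of the query fixed" (Bennett–Bernstein–Brassard–Vazirani 1997, §4), e.g.
on the keyed member `h_key` of a hash family with `key` written on the prefix wires (Zhandry 2012, Thm. 3.1), or on a
parametrised oracle `A⟨c⟩`.

* `retargetGate`, **`retarget`** — the syntactic transformation (gate symbols: `e ↦ e.trans emb`; oracle gates:
  `oracle k e ↦ oracle (P + k) (prefEmb p (e.trans emb))`); `length_retarget`;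
* `keyDiagonal_retargetGate`, **`keyDiagonal_retarget`** — the re-targeted circuit keeps the prefix wires classical
  (answer wires are never prefix wires), also w.r.t. any sub-register of the prefix (`KeyDiagonal.of_trans`);
* **`toMatrix_retarget_mulVec`** — BRANCHWISE SEMANTICS: on vectors supported on the branch `{z | z ∘ p = c}`, the
  re-targeted circuit relative to `A` acts as the transported ORIGINAL circuit relative to the slice
  `prefixSlice A (List.ofFn c)`; **`toMatrix_retarget_mulVec_eq_placeGate`** — equivalently as
  `placeGate emb (U_{gs}^{A⟨c⟩})` (by `toMatrix_mapWires`);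
* (appended) `retarget_append`, `isOracleFree_retargetGate_iff`, **`oracleQueries_retarget`** (the query count — the
  error budget of the later oracle substitution — is unchanged).

With `KeyAveragingHadamard.sum_normSq_hadamards_then_keyDiagonal` (Hadamards on a key sub-register of the prefix),
the event probabilities of "random key, then the re-targeted circuit" are the key-averages of those of the original
circuit relative to the key slices of `A`.

Everything here is PROVED; two definitions (`retargetGate`, `retarget`).

## References

* C. H. Bennett, E. Bernstein, G. Brassard, U. Vazirani, *Strengths and weaknesses of quantum computing*, SIAM J.
  Comput. 26 (1997) 1510–1523, §4 (oracle machines as subroutines; composing oracle calls)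
  [BennettBernsteinBrassardVazirani1997].
* M. A. Nielsen, I. L. Chuang, *Quantum Computation and Quantum Information*, CUP 2010, §6.1.1 (the oracle
  `|x⟩|q⟩ ↦ |x⟩|q ⊕ f(x)⟩`), §4.3–4.4 (placing gates; classical control registers) [NielsenChuang2010].
* M. Zhandry, *Secure identity-based encryption in the quantum random oracle model*, CRYPTO 2012, Thm. 3.1 [Zhandry2012].
-/

noncomputable section

namespace Literature.Computability.QuantumComplexity

open Cryptography Matrix Finset

/-! ### A sub-register of a classical register is classical -/

/-- Block-diagonality in a register passes to every sub-register. [cite: NielsenChuang2010, §4.4] -/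
theorem KeyDiagonal.of_trans {N P κ : ℕ} {p : Fin P ↪ Fin N} {U : Matrix (QReg N) (QReg N) ℂ}
    (hU : KeyDiagonal p U) (t : Fin κ ↪ Fin P) : KeyDiagonal (t.trans p) U := by
  intro x y hxy
  refine hU x y fun hp => hxy ?_
  funext j
  have := congrFun hp (t j)
  simpa only [Function.comp_apply, Function.Embedding.trans_apply] using this

variable {G : QGateSet} {N₀ N P : ℕ}
  (p : Fin P ↪ Fin N) (emb : Fin N₀ ↪ Fin N) (hdisj : ∀ a i, p a ≠ emb i)

/-! ### The re-targeting transformation -/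

/-- **Re-targeting one gate**: a gate symbol is transported along `emb`; an oracle query on `k` query wires becomes the
query on the `P` prefix wires followed by the transported `k` query wires, with the transported answer wire.
[cite: BennettBernsteinBrassardVazirani1997, §4 (oracle calls with part of the query tape fixed)] -/
def retargetGate : QGate G N₀ → QGate G N
  | .gate g e => .gate g (e.trans emb)
  | .oracle k e => .oracle (P + k) (prefEmb (P := P) (k := k) p (e.trans emb) (fun a b => hdisj a (e b)) :)

/-- **Re-targeting a gate list** (gatewise). [cite: BennettBernsteinBrassardVazirani1997, §4] -/
def retarget (gs : List (QGate G N₀)) : List (QGate G N) := gs.map (retargetGate p emb hdisj)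

/-- Re-targeting preserves the number of gates. [cite: BennettBernsteinBrassardVazirani1997, §4] -/
@[simp] theorem length_retarget (gs : List (QGate G N₀)) : (retarget p emb hdisj gs).length = gs.length := by
  simp [retarget]

/-- Re-targeting unfolds on a cons. [cite: BennettBernsteinBrassardVazirani1997, §4] -/
theorem retarget_cons (g : QGate G N₀) (gs : List (QGate G N₀)) :
    retarget p emb hdisj (g :: gs) = retargetGate p emb hdisj g :: retarget p emb hdisj gs := rfl

/-! ### The prefix wires stay classical -/

/-- A re-targeted gate keeps the prefix wires classical: gate symbols sit off the prefix, and the answer wire of a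
re-targeted query is a transported wire, hence off the prefix. [cite: NielsenChuang2010, §6.1.1] -/
theorem keyDiagonal_retargetGate (A : Language Bool) (g : QGate G N₀) :
    KeyDiagonal p ((retargetGate p emb hdisj g).toMatrix A) := by
  cases g with
  | gate g e =>
    exact KeyDiagonal.toMatrix_gate A g (e.trans emb) fun i a h' => hdisj a (e i) h'.symm
  | oracle k e =>
    refine KeyDiagonal.toMatrix_oracle A (P + k) (prefEmb (P := P) (k := k) p (e.trans emb) (fun a b => hdisj a (e b)) :)
      fun a h' => ?_
    rw [prefEmb_last] at h'
    exact hdisj a (e (Fin.last k)) h'.symm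

/-- **The re-targeted circuit keeps the prefix wires classical.** [cite: NielsenChuang2010, §4.4] -/
theorem keyDiagonal_retarget (A : Language Bool) (gs : List (QGate G N₀)) :
    KeyDiagonal p ((⟨retarget p emb hdisj gs⟩ : QCircuit G N).toMatrix A) :=
  KeyDiagonal.circuit A _ fun g hg => by
    obtain ⟨g₀, -, rfl⟩ := List.mem_map.1 hg
    exact keyDiagonal_retargetGate p emb hdisj A g₀

/-! ### Branchwise semantics -/

/-- One re-targeted gate, on vectors supported on the branch `{z | z ∘ p = c}`, acts as the transported original gate
relative to the slice of the oracle at `c`. [cite: NielsenChuang2010, §6.1.1] -/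
theorem toMatrix_retargetGate_mulVec (A : Language Bool) (c : QReg P) (g : QGate G N₀) {v : QReg N → ℂ}
    (hv : ∀ z, z ∘ p ≠ c → v z = 0) :
    (retargetGate p emb hdisj g).toMatrix A *ᵥ v =
      (mapWiresGate emb g).toMatrix (prefixSlice A (List.ofFn c)) *ᵥ v := by
  cases g with
  | gate g e => rfl
  | oracle k e => exact placeGate_oracleGate_prefEmb_mulVec p (e.trans emb) (fun a b => hdisj a (e b)) A c hv

include hdisj in
/-- A transported gate keeps the branch: it sits off the prefix wires. [cite: NielsenChuang2010, §4.3] -/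
theorem mapWiresGate_mulVec_supported (B : Language Bool) (c : QReg P) (g : QGate G N₀) {v : QReg N → ℂ}
    (hv : ∀ z, z ∘ p ≠ c → v z = 0) :
    ∀ z, z ∘ p ≠ c → ((mapWiresGate emb g).toMatrix B *ᵥ v) z = 0 := by
  intro z hz
  have hK : KeyDiagonal p ((mapWiresGate emb g).toMatrix B) := by
    rw [toMatrix_mapWiresGate]
    exact KeyDiagonal.placeGate_of_forall_ne emb _ fun i a h' => hdisj a i h'.symm
  exact KeyDiagonal.mulVec_eq_zero_of_supported hK hv hz

/-- **Branchwise semantics of re-targeting.** On vectors supported on the branch `{z | z ∘ p = c}`, the re-targeted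
circuit relative to the oracle `A` acts as the transported original circuit relative to the slice
`prefixSlice A (List.ofFn c)` ("the subroutine sees the oracle with the prefix fixed").
[cite: BennettBernsteinBrassardVazirani1997, §4] [cite: NielsenChuang2010, §6.1.1] -/
theorem toMatrix_retarget_mulVec (A : Language Bool) (c : QReg P) :
    ∀ (gs : List (QGate G N₀)) {v : QReg N → ℂ}, (∀ z, z ∘ p ≠ c → v z = 0) →
      (⟨retarget p emb hdisj gs⟩ : QCircuit G N).toMatrix A *ᵥ v =
        (⟨gs.map (mapWiresGate emb)⟩ : QCircuit G N).toMatrix (prefixSlice A (List.ofFn c)) *ᵥ v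
  | [], v, _ => by simp [retarget, QCircuit.toMatrix_nil]
  | g :: gs, v, hv => by
    rw [retarget_cons, List.map_cons, QCircuit.toMatrix_cons, QCircuit.toMatrix_cons, ← Matrix.mulVec_mulVec,
      ← Matrix.mulVec_mulVec, toMatrix_retargetGate_mulVec p emb hdisj A c g hv]
    exact toMatrix_retarget_mulVec A c gs (mapWiresGate_mulVec_supported p emb hdisj _ c g hv)

/-- **Branchwise semantics, placed form**: on the branch `c`, the re-targeted circuit acts as the original circuit's
unitary relative to `prefixSlice A (List.ofFn c)`, placed along `emb`.
[cite: BennettBernsteinBrassardVazirani1997, §4] [cite: NielsenChuang2010, §4.3] -/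
theorem toMatrix_retarget_mulVec_eq_placeGate (A : Language Bool) (c : QReg P) (gs : List (QGate G N₀))
    {v : QReg N → ℂ} (hv : ∀ z, z ∘ p ≠ c → v z = 0) :
    (⟨retarget p emb hdisj gs⟩ : QCircuit G N).toMatrix A *ᵥ v =
      placeGate emb ((⟨gs⟩ : QCircuit G N₀).toMatrix (prefixSlice A (List.ofFn c))) *ᵥ v := by
  rw [toMatrix_retarget_mulVec p emb hdisj A c gs hv, ← toMatrix_mapWires]
  rfl

/-- The output of the re-targeted circuit on a branch-supported input stays on the branch.
[cite: NielsenChuang2010, §4.4] -/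
theorem toMatrix_retarget_mulVec_supported (A : Language Bool) (c : QReg P) (gs : List (QGate G N₀))
    {v : QReg N → ℂ} (hv : ∀ z, z ∘ p ≠ c → v z = 0) :
    ∀ z, z ∘ p ≠ c → ((⟨retarget p emb hdisj gs⟩ : QCircuit G N).toMatrix A *ᵥ v) z = 0 :=
  fun _ hz => KeyDiagonal.mulVec_eq_zero_of_supported (keyDiagonal_retarget p emb hdisj A gs) hv hz


/-! ### Bookkeeping (appended): concatenation, oracle-freeness, oracle count -/

/-- Re-targeting commutes with concatenation. [cite: BennettBernsteinBrassardVazirani1997, §4] -/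
theorem retarget_append (gs gs' : List (QGate G N₀)) :
    retarget p emb hdisj (gs ++ gs') = retarget p emb hdisj gs ++ retarget p emb hdisj gs' := by
  simp [retarget]

/-- A re-targeted gate is oracle-free iff the original gate is. [cite: BennettBernsteinBrassardVazirani1997, §4] -/
theorem isOracleFree_retargetGate_iff (g : QGate G N₀) :
    (retargetGate p emb hdisj g).IsOracleFree ↔ g.IsOracleFree := by
  cases g with
  | gate g e => exact Iff.rfl
  | oracle k e => exact Iff.rfl

/-- **Re-targeting preserves the number of oracle gates** (the substitution error budget `numOracle · ε` of
`OracleImpl.kernelProb_substFamily_ge` is the original algorithm's query count).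
[cite: BennettBernsteinBrassardVazirani1997, §4 (the number of oracle calls)] -/
theorem oracleQueries_retarget (gs : List (QGate G N₀)) :
    (⟨retarget p emb hdisj gs⟩ : QCircuit G N).oracleQueries = (⟨gs⟩ : QCircuit G N₀).oracleQueries := by
  classical
  unfold QCircuit.oracleQueries
  induction gs with
  | nil => simp [retarget]
  | cons g gs ih =>
    simp only [retarget, List.map_cons] at ih ⊢
    by_cases hg : g.IsOracleFree
    · rw [List.filter_cons_of_neg (by simpa using (isOracleFree_retargetGate_iff p emb hdisj g).2 hg),
        List.filter_cons_of_neg (by simpa using hg), ih]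
    · rw [List.filter_cons_of_pos (by simpa using fun h' => hg ((isOracleFree_retargetGate_iff p emb hdisj g).1 h')),
        List.filter_cons_of_pos (by simpa using hg), List.length_cons, List.length_cons, ih]

end Literature.Computability.QuantumComplexity

end
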